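import Summits.BirchSwinnertonDyer.Rank1Residual.ManinAdditive.MinusOneTwistLatticeRotationProof
import Summits.BirchSwinnertonDyer.Rank1Residual.ManinAdditive.TwistOrbitDegreeIdentity
import Summits.BirchSwinnertonDyer.BirchSwinnertonDyer.Theorems.ManinLocalTwoThreeAdditiveDyadicTransport
import Literature.NumberTheory.EllipticCurves.ModularSymbolsProofs
import HarnessLib

/-!
# S-an-56 «the period lattice does not shrink from `Γ₀(N)` to `Γ₀(4N)` when `2 ∣ N`» and
# the LEVEL-RAISING `χ₋₄` ROTATION `Λ(f ⊗ χ₋₄) = i·Λ(f)` for `4 ∥ N → 16 ∥ 4N` (the body of an's E-an-145 `MinusOneLevelRaisingLatticeRotation`)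
# (route `ManinLocalTwoThree`, crux C2 `ManinOddAtFour` stmt-BirchSwinnertonDyer-22967; cell bsd-f2-manin, an g32 MEMO-an §75.3 ask «for -ty / p2»;
# width seat p2 gen 13)

* §1 **S-an-56** `periodLattice_le_periodLattice_charTwist_one_of_two_dvd` — for `f ∈ S₂(Γ₀(N))`, `2 ∣ N`, `N ∣ L ∣ 4N`:
  `Λ_{Γ₀(N)}(f) ⊆ Λ_{Γ₀(L)}(f̃)`, `f̃` the lift of `f` to level `L` by the trivial character mod `1` (tree `charTwist`, same
  modular symbols by the lead lineage's `maninLocalTwoThree_modularSymbol_charTwist_one`).  PROOF (MEMO-an §75.3 (2), made uniform):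
  for `γ = (a b; c d) ∈ Γ₀(N)` the integer `d` is odd (`2 ∣ N ∣ c`, `ad − bc = 1`), so with `t := c·d` (a multiple of `N`) the matrix
  `γ″ := γ·(1 0; −t 1) = (a − bt, b; c(1 − d²), d)` has lower-left entry divisible by `4N` (`4 ∣ 1 − d²`), hence lies in `Γ₀(L)`;
  `γ = γ″·δ` with `δ = (1 0; t 1) ∈ Γ₀(N)` PARABOLIC AT THE CUSP `0` (`δ·0 = 0`), so `{∞, δ∞}_f = 0` (Manin relation
  `modularSymbol_gamma0_smul` at `r = 0`) and `{∞, γ∞}_f = {∞, γ″∞}_f` (`cuspSymbol_mul`) `= {∞, γ″∞}_{f̃}` is a `Γ₀(L)`-period of `f̃`.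
* §2 **the level-raising `χ₋₄` ROTATION** `mem_periodLattice_iff_I_mul_mem_of_levelRaising` — the BODY of an g32's THEOREM CANDIDATE E-an-145
  `MinusOneLevelRaisingLatticeRotation` (census 43 845/43 845; «beyond-print: candidate YES»), stated inline (the by-name one-liner is the sequel
  `…MinusOneLevelRaisingRotation.lean`, waiting only for the farm build of the typer's leaf): for `W′ ~ W ⊗ χ₋₄` with `4 ∣ N(W)`, `N(W′) = 4·N(W)`
  and ANY `Γ₀`-data `D`, `D′` at the conductors, `z ∈ Λ(f′) ↔ i·z ∈ Λ(f)`.  PROOF = MEMO-an §75.3 over the tree: both curves are additive at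
  `2`, so `aₙ(f′) = χ₄(n)aₙ(f)` and `aₙ(f) = χ₄(n)aₙ(f′)` (`cuspCoeff_eq_chi_mul_of_twist_even`); (1) `f′ = charTwist_{N′}(f)` (q-expansions at
  level `N′ = 4N`), HALF-TRANSLATE for `f` at `4 ∣ N` (`maninLocalTwoThree_modularSymbol_add_half_eq_neg_of_four_dvd`) and the exact step
  `half_gaussSum_mul_mem_periodLattice_of_mem_charTwist` give `(g(χ₄)/2)·Λ(f′) ⊆ Λ(f)`; (2) `charTwist_{N′}(f′) = f̃` (the lift of `f`),
  HALF-TRANSLATE for `f′` at `16 ∣ N′` and the same exact step give `(g(χ₄)/2)·Λ_{Γ₀(N′)}(f̃) ⊆ Λ(f′)`, and §1 supplies `Λ(f) ⊆ Λ_{Γ₀(N′)}(f̃)`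
  (`half_gaussSum_χ₄_mul_mem_periodLattice_twoSided_levelRaising`); (3) `(g(χ₄)/2)² = −1`.

HONEST FRAMING: the rotation TRANSPORTS C2 between `4 ∥ N` and `16 ∥ 4N` (via an's proved edges E-an-145 ⟹ E-an-145R ⟹ `2 ∤ c ↔ 2 ∤ c′`) but does not
prove it on either stratum; E-an-145D (degree ×4) stays a LAW.  BSD is not proved by this file; Manin's conjecture is not proved; C2 `ManinOddAtFour` OPEN.
-/

set_option autoImplicit false
-- lint-debt: the directory name repeats the summit name (sibling precedent `ManinLocalTwoThreeAdditiveDyadicTransport.lean`)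
set_option linter.dupNamespace false

noncomputable section

open scoped MatrixGroups ModularForm

open CongruenceSubgroup WeierstrassCurve
  Literature.NumberTheory.DiophantineGeometry
  Literature.NumberTheory.EllipticCurves Literature.NumberTheory.EllipticCurves.ModularForms
  Summit.BirchSwinnertonDyer.Rank1Residual.ManinAdditive
  Summit.BirchSwinnertonDyer.BirchSwinnertonDyer.Theorems

namespace Summit.BirchSwinnertonDyer.BirchSwinnertonDyer.Theorems.ManinLocalTwoThree

/-! ## §1 S-an-56: `Λ_{Γ₀(N)}(f) ⊆ Λ_{Γ₀(L)}(lift f)` for `2 ∣ N`, `N ∣ L ∣ 4N` -/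

/-- For odd `d`, `4 ∣ 1 − d²`. [elementary] -/
theorem four_dvd_one_sub_sq_of_odd {d : ℤ} (hd : Odd d) : (4 : ℤ) ∣ 1 - d ^ 2 := by
  obtain ⟨k, rfl⟩ := hd
  exact ⟨-(k ^ 2 + k), by ring⟩

/-- The lower-right entry of `γ ∈ Γ₀(N)` is odd when `N` is even (`ad − bc = 1`, `2 ∣ N ∣ c`). [cite: DiamondShurman2005, §1.2] -/
theorem odd_apply_one_one_of_two_dvd {N : ℕ} (h2 : 2 ∣ N) (γ : Gamma0 N) : Odd ((γ : SL(2, ℤ)) 1 1 : ℤ) := by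
  have hdet : ((γ : SL(2, ℤ)) 0 0 : ℤ) * (γ : SL(2, ℤ)) 1 1 - (γ : SL(2, ℤ)) 0 1 * (γ : SL(2, ℤ)) 1 0 = 1 := by
    have h := Matrix.SpecialLinearGroup.det_coe (γ : SL(2, ℤ))
    rw [Matrix.det_fin_two] at h
    exact h
  have hc : (2 : ℤ) ∣ (γ : SL(2, ℤ)) 1 0 :=
    (Int.natCast_dvd_natCast.mpr h2).trans (dvd_entry_of_mem_Gamma0 N γ.2)
  rw [← Int.not_even_iff_odd]
  rintro ⟨k, hk⟩
  obtain ⟨m, hm⟩ := hc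
  rw [hk, hm] at hdet
  have : (2 : ℤ) ∣ 1 := ⟨(γ : SL(2, ℤ)) 0 0 * k - (γ : SL(2, ℤ)) 0 1 * m, by linear_combination -hdet⟩
  omega

/-- A matrix of `Γ₀(N)` fixing the cusp `0` has trivial period: `{∞, δ∞}_f = 0` for `δ = (1 0; t 1)`, `N ∣ t`
(the Manin relation `{∞, δ·0}_f = {∞, δ∞}_f + {∞, 0}_f` with `δ·0 = 0`). [cite: Manin1972, Prop. 1.4, Thm. 1.6] -/
theorem cuspSymbol_eq_zero_of_apply_eq {N : ℕ} [NeZero N] (f : CuspForm (Gamma0 N) 2) (δ : Gamma0 N)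
    (h00 : ((δ : SL(2, ℤ)) 0 0 : ℤ) = 1) (h01 : ((δ : SL(2, ℤ)) 0 1 : ℤ) = 0) (h11 : ((δ : SL(2, ℤ)) 1 1 : ℤ) = 1) :
    cuspSymbol f δ = 0 := by
  have h := modularSymbol_gamma0_smul_holds f δ 0 (by rw [h11]; norm_num)
  rw [h00, h01, h11] at h
  norm_num at h
  linear_combination h

/-- **S-an-56 (an g32, MEMO-an §75.3 (2)).**  For `f ∈ S₂(Γ₀(N))` with `2 ∣ N` and a level `L` with `N ∣ L ∣ 4N`, every `Γ₀(N)`-period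
of `f` is a `Γ₀(L)`-period of the lift `f̃` of `f` to level `L` (the twist by the trivial character mod `1`):
`Λ_{Γ₀(N)}(f) ⊆ Λ_{Γ₀(L)}(f̃)`.  (The reverse inclusion is trivial; geometrically `X₀(4N) → X₀(N)` is totally ramified over the cusp `0`.)
[cite: Manin1972, Prop. 1.4, Thm. 1.6] [cite: Shimura1971, Prop. 3.64] -/
theorem periodLattice_le_periodLattice_charTwist_one_of_two_dvd {N : ℕ} [NeZero N] (L : ℕ) [NeZero L]
    (hNL : N ∣ L) (hL : L ∣ 4 * N) (hm : 1 ^ 2 ∣ L) (h2 : 2 ∣ N) (f : CuspForm (Gamma0 N) 2) :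
    periodLattice f ≤ periodLattice (charTwist L hNL hm maninLocalTwoThree_isQuadratic_one_level_one f) := by
  rw [periodLattice, AddSubgroup.closure_le]
  rintro _ ⟨γ, rfl⟩
  -- entries of `γ`
  set a : ℤ := (γ : SL(2, ℤ)) 0 0 with ha
  set b : ℤ := (γ : SL(2, ℤ)) 0 1 with hb
  set c : ℤ := (γ : SL(2, ℤ)) 1 0 with hc
  set d : ℤ := (γ : SL(2, ℤ)) 1 1 with hd
  have hdet : a * d - b * c = 1 := by
    have h := Matrix.SpecialLinearGroup.det_coe (γ : SL(2, ℤ))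
    rw [Matrix.det_fin_two] at h
    exact h
  have hNc : (N : ℤ) ∣ c := dvd_entry_of_mem_Gamma0 N γ.2
  have hdodd : Odd d := odd_apply_one_one_of_two_dvd h2 γ
  -- the parabolic correction `δ = (1 0; t 1)`, `t = c·d`
  set t : ℤ := c * d with ht
  let δM : SL(2, ℤ) := ⟨!![1, 0; t, 1], by rw [Matrix.det_fin_two_of]; ring⟩
  have hδmem : δM ∈ Gamma0 N := by
    rw [Gamma0_mem]
    show (((!![(1 : ℤ), 0; t, 1]) 1 0 : ℤ) : ZMod N) = 0
    simp only [Matrix.of_apply, Matrix.cons_val', Matrix.cons_val_zero, Matrix.cons_val_one,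
      Matrix.cons_val_fin_one]
    rw [ZMod.intCast_zmod_eq_zero_iff_dvd, ht]
    exact dvd_mul_of_dvd_left hNc d
  let δ : Gamma0 N := ⟨δM, hδmem⟩
  -- `γ″ = γ·δ⁻¹ = (a − bt, b; c − dt, d)`
  let γM : SL(2, ℤ) := ⟨!![a - b * t, b; c - d * t, d], by
    rw [Matrix.det_fin_two_of]; linear_combination hdet⟩
  have hγ''L : γM ∈ Gamma0 L := by
    rw [Gamma0_mem]
    show (((!![a - b * t, b; c - d * t, d]) 1 0 : ℤ) : ZMod L) = 0
    simp only [Matrix.of_apply, Matrix.cons_val', Matrix.cons_val_zero, Matrix.cons_val_one,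
      Matrix.cons_val_fin_one]
    rw [ZMod.intCast_zmod_eq_zero_iff_dvd]
    have h4 : (4 : ℤ) ∣ 1 - d ^ 2 := four_dvd_one_sub_sq_of_odd hdodd
    have hL' : (L : ℤ) ∣ 4 * (N : ℤ) := by exact_mod_cast hL
    refine hL'.trans ?_
    obtain ⟨c', hc'⟩ := hNc
    obtain ⟨e, he⟩ := h4
    exact ⟨c' * e, by rw [ht, hc']; linear_combination (N : ℤ) * c' * he⟩
  have hγ''N : γM ∈ Gamma0 N := by
    rw [Gamma0_mem]
    show (((!![a - b * t, b; c - d * t, d]) 1 0 : ℤ) : ZMod N) = 0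
    simp only [Matrix.of_apply, Matrix.cons_val', Matrix.cons_val_zero, Matrix.cons_val_one,
      Matrix.cons_val_fin_one]
    rw [ZMod.intCast_zmod_eq_zero_iff_dvd]
    obtain ⟨c', hc'⟩ := hNc
    exact ⟨c' * (1 - d ^ 2), by rw [ht, hc']; ring⟩
  let γ'' : Gamma0 N := ⟨γM, hγ''N⟩
  have hprod : γ = γ'' * δ := by
    apply Subtype.ext
    apply Subtype.ext
    show ((γ : SL(2, ℤ)) : Matrix (Fin 2) (Fin 2) ℤ) = !![a - b * t, b; c - d * t, d] * !![(1 : ℤ), 0; t, 1]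
    ext i j
    fin_cases i <;> fin_cases j <;>
      simp [Matrix.mul_apply, Fin.sum_univ_two, ha, hb, hc, hd]
  -- periods
  have hsum := cuspSymbol_mul_holds f γ'' δ
  rw [← hprod] at hsum
  have hδ0 : cuspSymbol f δ = 0 := cuspSymbol_eq_zero_of_apply_eq f δ rfl rfl rfl
  rw [hsum, hδ0, add_zero]
  -- the period of `γ″` over `Γ₀(L)` for the lift
  have key : cuspSymbol f γ'' =
      cuspSymbol (charTwist L hNL hm maninLocalTwoThree_isQuadratic_one_level_one f) ⟨γM, hγ''L⟩ := by
    unfold cuspSymbol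
    show (if (γM 1 0 : ℤ) = 0 then (0 : ℂ) else modularSymbol f (((γM 0 0 : ℤ) : ℚ) / ((γM 1 0 : ℤ) : ℚ))) =
      (if (γM 1 0 : ℤ) = 0 then (0 : ℂ) else
        modularSymbol (charTwist L hNL hm maninLocalTwoThree_isQuadratic_one_level_one f)
          (((γM 0 0 : ℤ) : ℚ) / ((γM 1 0 : ℤ) : ℚ)))
    rw [maninLocalTwoThree_modularSymbol_charTwist_one]
  rw [key]
  exact cuspSymbol_mem_periodLattice _ _


/-! ## §2 E-an-145 BY NAME: the level-raising `χ₋₄` rotation `Λ(f′) = i·Λ(f)` -/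

/-- **The two-sided EXACT STEP at `χ₄` across a LEVEL-RAISING `χ₋₄`-pair** (`4 ∣ N(W)`, `N(W′) = 4·N(W)`,
`W ⊗ χ₋₄ ~ W′`; `D`, `D′` any `Γ₀`-data at the conductors): `(g(χ₄)/2)·Λ(f′) ⊆ Λ(f)` AND `(g(χ₄)/2)·Λ(f) ⊆ Λ(f′)`.
The first inclusion is the lead lineage's engine (half-translate at `4 ∣ N` through the lift); the second runs the same exact step at
level `N′` for `f′` (whose `χ₄`-twist is the LIFT `f̃` of `f`) and then uses S-an-56 `Λ(f) ⊆ Λ_{Γ₀(N′)}(f̃)`.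
[cite: Stevens1989, Lemma (5.4) p. 97] [cite: Cremona1997, §2.8] [cite: Manin1972, Prop. 1.4, Thm. 1.6] -/
theorem half_gaussSum_χ₄_mul_mem_periodLattice_twoSided_levelRaising {W W' : WeierstrassCurve ℚ} [W.IsElliptic]
    [W'.IsElliptic] [NeZero (W.conductorNorm ℤ)] [NeZero (W'.conductorNorm ℤ)]
    (D : ModularParametrizationData W (W.conductorNorm ℤ))
    (D' : ModularParametrizationData W' (W'.conductorNorm ℤ)) (h4 : 2 ^ 2 ∣ W.conductorNorm ℤ)
    (hN : W'.conductorNorm ℤ = 4 * W.conductorNorm ℤ)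
    (hiso : IsIsogenous (W.quadraticTwist ((-1 : ℤ) : ℚ)) W') :
    (∀ w ∈ periodLattice D'.f,
      gaussSum (ZMod.χ₄.ringHomComp (Int.castRingHom ℂ)) (ZMod.stdAddChar (N := 4)) / 2 * w ∈
        periodLattice D.f) ∧
    (∀ w ∈ periodLattice D.f,
      gaussSum (ZMod.χ₄.ringHomComp (Int.castRingHom ℂ)) (ZMod.stdAddChar (N := 4)) / 2 * w ∈
        periodLattice D'.f) := by
  haveI : Fact (Nat.Prime 2) := ⟨Nat.prime_two⟩
  haveI : NeZero (4 : ℕ) := ⟨by norm_num⟩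
  haveI : NeZero (1 : ℕ) := ⟨one_ne_zero⟩
  have hχ : (ZMod.χ₄.ringHomComp (Int.castRingHom ℂ)).IsQuadratic := isQuadratic_χ₄_ringHomComp
  have hprim : DirichletCharacter.IsPrimitive (ZMod.χ₄.ringHomComp (Int.castRingHom ℂ)) :=
    isPrimitive_χ₄_ringHomComp
  have hd0 : ((-1 : ℤ) : ℚ) ≠ 0 := by norm_num
  haveI := W.isElliptic_quadraticTwist hd0
  -- divisibilities of the two levels
  have h4N : 4 ∣ W.conductorNorm ℤ := by simpa using h4
  have h2N : 2 ∣ W.conductorNorm ℤ := dvd_trans (by norm_num) h4N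
  have hNdvd : W.conductorNorm ℤ ∣ W'.conductorNorm ℤ := ⟨4, by rw [hN, mul_comm]⟩
  have hL4 : W'.conductorNorm ℤ ∣ 4 * W.conductorNorm ℤ := by rw [hN]
  have hM' : 4 ^ 2 ∣ W'.conductorNorm ℤ := by
    rw [hN, pow_two]; exact Nat.mul_dvd_mul_left 4 h4N
  have h4' : 2 ^ 2 ∣ W'.conductorNorm ℤ := dvd_trans (by norm_num) hM'
  have hN'N' : W'.conductorNorm ℤ ∣ W'.conductorNorm ℤ := dvd_rfl
  have hm1 : 1 ^ 2 ∣ W'.conductorNorm ℤ := by rw [one_pow]; exact one_dvd _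
  -- both curves are additive at `2`: even coefficients vanish
  obtain ⟨hngW, hnmW⟩ := not_good_and_not_mult_of_sq_dvd_conductorNorm W h4
  obtain ⟨hngW', hnmW'⟩ := not_good_and_not_mult_of_sq_dvd_conductorNorm W' h4'
  have hW0 : ∀ n : ℕ, 2 ∣ n → W.LFunction n = 0 := fun n hn ↦
    W.LFunction_apply_eq_zero_of_not_good_of_not_mult 2 hngW hnmW hn
  have hW'0 : ∀ n : ℕ, 2 ∣ n → W'.LFunction n = 0 := fun n hn ↦
    W'.LFunction_apply_eq_zero_of_not_good_of_not_mult 2 hngW' hnmW' hn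
  have hu : (1 : VariableChange ℚ) • W.quadraticTwist ((-1 : ℤ) : ℚ) =
      W.quadraticTwist ((-1 : ℤ) : ℚ) := one_smul _ _
  have hodd : ∀ n : ℕ, ¬ 2 ∣ n → (((W.quadraticTwist ((-1 : ℤ) : ℚ)).LFunction n : ℤ) : ℂ) =
      (ZMod.χ₄.ringHomComp (Int.castRingHom ℂ)) n * (W.LFunction n : ℂ) := fun n hn ↦ by
    rw [show ((-1 : ℤ) : ℚ) = -1 by norm_num, W.LFunction_quadraticTwist_neg_one_apply_of_odd hn,
      Int.cast_mul, χ₄_ringHomComp_apply_natCast]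
  have heven : ∀ n : ℕ, 2 ∣ n → (ZMod.χ₄.ringHomComp (Int.castRingHom ℂ)) n = 0 := fun n hn ↦ by
    rw [χ₄_ringHomComp_apply_natCast, ZMod.χ₄_nat_eq_if_mod_four, if_pos (Nat.mod_eq_zero_of_dvd hn)]
    simp
  have hsq : ∀ n : ℕ, ¬ 2 ∣ n → (ZMod.χ₄.ringHomComp (Int.castRingHom ℂ)) n *
      (ZMod.χ₄.ringHomComp (Int.castRingHom ℂ)) n = 1 := fun n hn ↦ by
    rw [χ₄_ringHomComp_apply_natCast, ZMod.χ₄_nat_eq_if_mod_four,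
      if_neg (fun h ↦ hn (Nat.dvd_of_mod_eq_zero h))]
    split_ifs <;> push_cast <;> ring
  have hcoef : ∀ n : ℕ, cuspCoeff D'.f n = (ZMod.χ₄.ringHomComp (Int.castRingHom ℂ)) n * cuspCoeff D.f n :=
    fun n ↦ cuspCoeff_eq_chi_mul_of_twist_even hd0 1 hu hiso.LFunction_eq hodd heven hW'0 D D' n
  have hevenD : ∀ n : ℕ, 2 ∣ n → cuspCoeff D.f n = 0 := fun n hn ↦ by
    rw [D.isNewformOf.2 n, hW0 n hn, Int.cast_zero]
  have hevenD' : ∀ n : ℕ, 2 ∣ n → cuspCoeff D'.f n = 0 := fun n hn ↦ by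
    rw [D'.isNewformOf.2 n, hW'0 n hn, Int.cast_zero]
  -- (1) `f′ = charTwist_{N′}(f)` at level `N′ = 4N`
  have htw' : charTwist (W'.conductorNorm ℤ) hNdvd hM' hχ D.f = D'.f :=
    eq_of_forall_cuspCoeff_eq_gamma0 fun n ↦ by rw [cuspCoeff_charTwist _ hNdvd hM' hχ hprim, hcoef n]
  -- (2) `charTwist_{N′}(f′) = f̃`, the lift of `f` to level `N′`
  set flift : CuspForm (Gamma0 (W'.conductorNorm ℤ)) 2 :=
    charTwist (W'.conductorNorm ℤ) hNdvd hm1 maninLocalTwoThree_isQuadratic_one_level_one D.f with hflift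
  have h1n : ∀ n : ℕ, (1 : DirichletCharacter ℂ 1) (n : ZMod 1) = 1 := fun n ↦
    MulChar.one_apply (isUnit_of_subsingleton _)
  have htw : charTwist (W'.conductorNorm ℤ) hN'N' hM' hχ D'.f = flift :=
    eq_of_forall_cuspCoeff_eq_gamma0 fun n ↦ by
      rw [cuspCoeff_charTwist _ hN'N' hM' hχ hprim, hcoef n, ← mul_assoc, hflift,
        cuspCoeff_charTwist _ hNdvd hm1 maninLocalTwoThree_isQuadratic_one_level_one
          DirichletCharacter.isPrimitive_one_level_one, h1n n, one_mul]
      by_cases h2 : 2 ∣ n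
      · rw [hevenD n h2, mul_zero]
      · rw [hsq n h2, one_mul]
  -- half-translate on both sides
  have hhalf : ∀ x : ℚ, modularSymbol D.f (x + 1 / 2) = -modularSymbol D.f x :=
    maninLocalTwoThree_modularSymbol_add_half_eq_neg_of_four_dvd D.f h4N hevenD
  have hhalf' : ∀ x : ℚ, modularSymbol D'.f (x + 1 / 2) = -modularSymbol D'.f x :=
    modularSymbol_add_half_eq_neg D'.f hM' hevenD'
  refine ⟨fun w hw ↦ ?_, fun w hw ↦ ?_⟩
  · rw [← htw'] at hw
    exact half_gaussSum_mul_mem_periodLattice_of_mem_charTwist _ hNdvd hM' hχ hprim D.f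
      (fun x ↦ ⟨1, 3, 0, sum_χ₄_modularSymbol_of_half D.f hhalf x⟩) hw
  · -- S-an-56: `w` is a `Γ₀(N′)`-period of the lift
    have hw' : w ∈ periodLattice flift :=
      periodLattice_le_periodLattice_charTwist_one_of_two_dvd (W'.conductorNorm ℤ) hNdvd hL4 hm1 h2N D.f hw
    rw [← htw] at hw'
    exact half_gaussSum_mul_mem_periodLattice_of_mem_charTwist _ hN'N' hM' hχ hprim D'.f
      (fun x ↦ ⟨1, 3, 0, sum_χ₄_modularSymbol_of_half D'.f hhalf' x⟩) hw'

/-- **The level-raising `χ₋₄` ROTATION `Λ(f′) = i·Λ(f)`** = the BODY of an's E-an-145 `MinusOneLevelRaisingLatticeRotation` (cell bsd-f2-manin,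
an g32 MEMO-an §75; census 43 845/43 845; the by-name corollary is the sequel file, once the typer's leaf `MinusOneLevelRaising` has an olean), WITHOUT
the global-minimality binders:
on every LEVEL-RAISING `χ₋₄`-pair (`4 ∣ N(W)`, `N(W′) = 4·N(W)`, `W ⊗ χ₋₄ ~ W′`; `D`, `D′` any `Γ₀`-data at the conductors),
`z ∈ Λ(f′) ⟺ i·z ∈ Λ(f)` — from the two-sided exact step and `(g(χ₄)/2)² = −1`.
[cite: Stevens1989, Lemma (5.4) p. 97] [cite: Cremona1997, §2.8] -/
theorem mem_periodLattice_iff_I_mul_mem_of_levelRaising {W W' : WeierstrassCurve ℚ} [W.IsElliptic]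
    [W'.IsElliptic] [NeZero (W.conductorNorm ℤ)] [NeZero (W'.conductorNorm ℤ)]
    (D : ModularParametrizationData W (W.conductorNorm ℤ))
    (D' : ModularParametrizationData W' (W'.conductorNorm ℤ)) (h4 : 2 ^ 2 ∣ W.conductorNorm ℤ)
    (hN : W'.conductorNorm ℤ = 4 * W.conductorNorm ℤ)
    (hiso : IsIsogenous (W.quadraticTwist ((-1 : ℤ) : ℚ)) W') (z : ℂ) :
    z ∈ periodLattice D'.f ↔ Complex.I * z ∈ periodLattice D.f := by
  obtain ⟨h₁, h₂⟩ := half_gaussSum_χ₄_mul_mem_periodLattice_twoSided_levelRaising D D' h4 hN hiso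
  have hs : (gaussSum (ZMod.χ₄.ringHomComp (Int.castRingHom ℂ)) (ZMod.stdAddChar (N := 4)) / 2) ^ 2 =
      Complex.I ^ 2 := by
    rw [div_pow, gaussSum_χ₄_ringHomComp_sq, Complex.I_sq]; norm_num
  rcases sq_eq_sq_iff_eq_or_eq_neg.mp hs with hI | hI
  · constructor
    · intro hz
      have := h₁ z hz
      rwa [hI] at this
    · intro hz
      have := h₂ _ hz
      rw [hI, ← mul_assoc, Complex.I_mul_I, neg_one_mul] at this
      exact neg_mem_iff.mp this
  · constructor
    · intro hz
      have := h₁ z hz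
      rw [hI, neg_mul] at this
      exact neg_mem_iff.mp this
    · intro hz
      have := h₂ _ hz
      rw [hI, neg_mul, ← mul_assoc, Complex.I_mul_I, neg_one_mul, neg_neg] at this
      exact this


end Summit.BirchSwinnertonDyer.BirchSwinnertonDyer.Theorems.ManinLocalTwoThree

end
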